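import Mathlib
import Summits.NavierStokesRegularity.NavierStokesRegularity.Theorems.FilamentSkeletonRssSkeletonJ1RLiaShooting

/-!
# Route `FilamentSkeletonRss` · crux `SkeletonJ1R` (stmt-NavierStokesRegularity-23610) · registered line `streamline_kantorovich_R`
# — brick F(i)-b for stub F `LiaFrameL`: the NEAR-STRAIGHTNESS BOOTSTRAP for position-cut-off filament equations

Lead `ns-fsr-lead-23610` (g0), `--supports stmt-NavierStokesRegularity-23610 --as helper`; route-independent, Γ-free.

WHY.  The LIA reference of the registered skeleton (`SkeletonJ1RFrame.IsLiaReference`) is cut off in POSITION: `x″ = (β⁻¹φ(x)) • x′ × W(x)`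
with `φ = 0` outside the ball `‖y‖² ≥ 3ℓ²`.  Unlike the rung ladder's parameter cutoff (`…RungModelArc`, where `∫‖x″‖` is bounded a priori by
the length of the cutoff window), the time the reference spends inside the ball — hence its total turning — is controlled only through its own
near-straightness (a near-straight arc crosses the ball in parameter length `≤ 2(R + ‖x 0‖) + 1`), and the size of the ambient field `W` along the
arc is controlled only while the arc stays away from the partners' datum lines, which again needs near-straightness.  This file packages the
circularity once and for all as two Γ-free lemmas about a unit-speed `C²` curve `x` with `x′ 0 = e`:

* `tilt_le_of_curvature_of_exit` (the STEP) — if on `[0, T]` the tilt `‖x′ − e‖` is `≤ θ₁ ≤ ½`, the curvature is `≤ κ`, and the curvature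
  VANISHES wherever `‖x‖ > R`, then on `[0, T]` the tilt is in fact `≤ κ · (2(R + ‖x 0‖) + 1)` (axial progress `⟪x σ − x 0, e⟫ ≥ σ/2` forces
  `‖x σ‖ > R` for `σ ≥ 2(R + ‖x 0‖) + 1`, after which the tangent is frozen);
* `nearStraight_bootstrap` (CONTINUOUS INDUCTION) — if `θ₀ < θ₁` and, for every `T ≥ 0`, "tilt `≤ θ₁` on `[0, T]`" implies "tilt `≤ θ₀` on
  `[0, T]`", then the tilt is `≤ θ₀` on all of `[0, ∞)` (first-exit-time argument: the infimum of `{τ ≥ 0 : θ₁ ≤ tilt τ}` would be a time where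
  the hypothesis holds and the conclusion fails);
* `nearStraight_of_conditional_curvature` — the two combined: a conditional curvature bound "tilt `≤ θ₁` on `[0,T]` ⇒ curvature `≤ κ` on
  `[0,T]`", flatness outside radius `R`, and `κ(2(R + ‖x 0‖) + 1) ≤ θ₀ < θ₁ ≤ ½` give tilt `≤ θ₀` on `[0, ∞)`.
The backward half-line follows by time reversal (`nearStraight_of_conditional_curvature_neg`).

HONEST FRAMING.  ODE bookkeeping for the ∃-side of a HYPOTHETICAL filament-type rotating-self-similar blow-up skeleton (MODEL rung, negative
side); nothing here is a claim about Navier–Stokes regularity or blow-up; stub F and the crux stay OPEN.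
-/

set_option linter.dupNamespace false -- `NavierStokesRegularity.NavierStokesRegularity` path/namespace repetition is the tree convention

noncomputable section

namespace Summit.NavierStokesRegularity.NavierStokesRegularity.Theorems.SkeletonJ1RFrame

open Set Function Filter Real Topology
open scoped InnerProductSpace

/-! ## §1 The step: curvature bound + flatness outside a ball ⇒ improved tilt -/

/-- **Radial escape of a near-straight arc.**  If `x` is `C¹` with `‖x′ σ − e‖ ≤ θ₁ ≤ ½` on `[0, T]` (`‖e‖ = 1`) then
`‖x σ‖ ≥ σ/2 − ‖x 0‖` for `σ ∈ [0, T]`. [folklore] -/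
theorem norm_ge_of_nearStraightOn {x : ℝ → EuclideanSpace ℝ (Fin 3)} (hx : ContDiff ℝ 1 x) {e : EuclideanSpace ℝ (Fin 3)}
    (he : ‖e‖ = 1) {θ₁ T : ℝ} (hθ₁ : θ₁ ≤ 1 / 2) (htilt : ∀ σ ∈ Icc 0 T, ‖deriv x σ - e‖ ≤ θ₁) {σ : ℝ} (hσ : σ ∈ Icc 0 T) :
    σ / 2 - ‖x 0‖ ≤ ‖x σ‖ := by
  have hprog := inner_progress_of_nearStraightOn hx he htilt hσ
  have hcs : inner ℝ (x σ - x 0) e ≤ ‖x σ - x 0‖ := by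
    have := real_inner_le_norm (x σ - x 0) e
    rwa [he, mul_one] at this
  have htri : ‖x σ - x 0‖ ≤ ‖x σ‖ + ‖x 0‖ := norm_sub_le _ _
  nlinarith [hσ.1]

/-- **The step of the bootstrap.**  Let `x` be `C²` with unit speed and `x′ 0 = e`.  If on `[0, T]` the tilt is `≤ θ₁ ≤ ½` and the curvature is
`≤ κ` (`κ ≥ 0`), and the curvature vanishes wherever `‖x‖ > R` (`R ≥ 0`), then on `[0, T]` the tilt is `≤ κ (2(R + ‖x 0‖) + 1)`. [folklore] -/
theorem tilt_le_of_curvature_of_exit {x : ℝ → EuclideanSpace ℝ (Fin 3)} (hx : ContDiff ℝ 2 x) {e : EuclideanSpace ℝ (Fin 3)}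
    (he : ‖e‖ = 1) (h0 : deriv x 0 = e) {κ R T θ₁ : ℝ} (hκ : 0 ≤ κ) (hR : 0 ≤ R) (hθ₁ : θ₁ ≤ 1 / 2)
    (htilt : ∀ σ ∈ Icc 0 T, ‖deriv x σ - e‖ ≤ θ₁) (hcurv : ∀ σ ∈ Icc 0 T, ‖iteratedDeriv 2 x σ‖ ≤ κ)
    (hflat : ∀ σ, R < ‖x σ‖ → iteratedDeriv 2 x σ = 0) :
    ∀ σ ∈ Icc 0 T, ‖deriv x σ - e‖ ≤ κ * (2 * (R + ‖x 0‖) + 1) := by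
  set τe : ℝ := 2 * (R + ‖x 0‖) + 1 with hτe
  have hx1 : ContDiff ℝ 1 x := hx.of_le (by norm_num)
  intro σ hσ
  by_cases hle : σ ≤ τe
  · -- before the exit bound: turning ≤ κ σ ≤ κ τe
    have h := norm_deriv_sub_le_of_curvature_le hx hσ.1 fun τ hτ => hcurv τ ⟨hτ.1, hτ.2.trans hσ.2⟩
    rw [h0, sub_zero] at h
    exact h.trans (mul_le_mul_of_nonneg_left hle hκ)
  · -- after it: the curve is outside the ball on `[τe, σ]`, so the tangent is frozen at `τe`
    push Not at hle
    have hτe0 : 0 ≤ τe := by positivity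
    have hout : ∀ τ ∈ Icc τe σ, iteratedDeriv 2 x τ = 0 := by
      intro τ hτ
      apply hflat
      have hτT : τ ∈ Icc 0 T := ⟨hτe0.trans hτ.1, hτ.2.trans hσ.2⟩
      have h := norm_ge_of_nearStraightOn hx1 he hθ₁ htilt hτT
      have : R < τ / 2 - ‖x 0‖ := by rw [hτe] at hτ; linarith [hτ.1]
      linarith
    have hfrozen : deriv x σ = deriv x τe := deriv_eq_of_curvature_zero hx hle.le hout
    have h := norm_deriv_sub_le_of_curvature_le hx hτe0 fun τ hτ => hcurv τ ⟨hτ.1, hτ.2.trans (hle.le.trans hσ.2)⟩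
    rw [h0, sub_zero] at h
    rw [hfrozen]
    linarith

/-! ## §2 Continuous induction on the tilt -/

/-- **Near-straightness bootstrap (continuous induction).**  Let `x` be `C¹` with `x′ 0 = e` and `θ₀ < θ₁`, `0 ≤ θ₁`.  If for every `T ≥ 0` the weak
bound "tilt `≤ θ₁` on `[0, T]`" implies the strong bound "tilt `≤ θ₀` on `[0, T]`", then the tilt is `≤ θ₀` on `[0, ∞)`.  (If the weak bound
ever failed, the first time `τ⋆ = inf {τ ≥ 0 : θ₁ ≤ ‖x′ τ − e‖}` would satisfy the weak bound on `[0, τ⋆]` by minimality and continuity, hence the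
strong bound at `τ⋆`, contradicting `θ₁ ≤ ‖x′ τ⋆ − e‖`.) [folklore] -/
theorem nearStraight_bootstrap {x : ℝ → EuclideanSpace ℝ (Fin 3)} (hx : ContDiff ℝ 1 x) {e : EuclideanSpace ℝ (Fin 3)}
    (h0 : deriv x 0 = e) {θ₀ θ₁ : ℝ} (hθ : θ₀ < θ₁) (hθ₁ : 0 ≤ θ₁)
    (hstep : ∀ T, 0 ≤ T → (∀ σ ∈ Icc 0 T, ‖deriv x σ - e‖ ≤ θ₁) → ∀ σ ∈ Icc 0 T, ‖deriv x σ - e‖ ≤ θ₀) :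
    ∀ τ, 0 ≤ τ → ‖deriv x τ - e‖ ≤ θ₀ := by
  have hcont : Continuous fun τ => ‖deriv x τ - e‖ := ((hx.continuous_deriv le_rfl).sub continuous_const).norm
  -- the bad set
  set B : Set ℝ := {τ | 0 ≤ τ ∧ θ₁ ≤ ‖deriv x τ - e‖} with hB
  by_cases hBe : B = ∅
  · -- no bad time: the weak bound holds on every `[0, T]`
    intro τ hτ
    refine hstep τ hτ (fun σ hσ => ?_) τ ⟨hτ, le_rfl⟩
    by_contra h
    push Not at h
    have : σ ∈ B := ⟨hσ.1, h.le⟩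
    rw [hBe] at this
    exact this
  · have hBne : B.Nonempty := nonempty_iff_ne_empty.2 hBe
    have hBclosed : IsClosed B := by
      have : B = Ici 0 ∩ (fun τ => ‖deriv x τ - e‖) ⁻¹' Ici θ₁ := by
        ext τ; simp [hB]
      rw [this]
      exact isClosed_Ici.inter (isClosed_Ici.preimage hcont)
    have hBbdd : BddBelow B := ⟨0, fun τ hτ => hτ.1⟩
    set τs := sInf B with hτs
    have hτsB : τs ∈ B := hBclosed.csInf_mem hBne hBbdd
    have hτs0 : 0 ≤ τs := hτsB.1
    -- weak bound on `[0, τs]`: strictly before `τs` no time is bad; at `τs` by continuity from the left (or `τs = 0`)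
    have hweak_lt : ∀ σ, 0 ≤ σ → σ < τs → ‖deriv x σ - e‖ < θ₁ := by
      intro σ hσ0 hσlt
      by_contra h
      push Not at h
      have : τs ≤ σ := csInf_le hBbdd ⟨hσ0, h⟩
      linarith
    have hweak : ∀ σ ∈ Icc 0 τs, ‖deriv x σ - e‖ ≤ θ₁ := by
      intro σ hσ
      rcases hσ.2.lt_or_eq with hlt | heq
      · exact (hweak_lt σ hσ.1 hlt).le
      · -- σ = τs: either τs = 0 (tilt 0 = 0 ≤ θ₁... only if 0 ≤ θ₁; use instead closedness from the left) or a limit from the left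
        rw [heq]
        rcases hτs0.lt_or_eq with hpos | hzero
        · -- limit from the left
          have hlim : Tendsto (fun σ => ‖deriv x σ - e‖) (𝓝[<] τs) (𝓝 ‖deriv x τs - e‖) :=
            (hcont.tendsto τs).mono_left nhdsWithin_le_nhds
          refine le_of_tendsto hlim ?_
          have : ∀ᶠ σ in 𝓝[<] τs, 0 < σ := mem_nhdsWithin_of_mem_nhds (Ioi_mem_nhds hpos)
          filter_upwards [this, self_mem_nhdsWithin] with σ hσ0 hσlt
          exact (hweak_lt σ hσ0.le hσlt).le
        · -- τs = 0: tilt 0 = 0 ≤ θ₁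
          rw [← hzero, h0, sub_self, norm_zero]
          exact hθ₁
    have hstrong := hstep τs hτs0 hweak τs ⟨hτs0, le_rfl⟩
    have hbad := hτsB.2
    intro τ hτ
    exfalso
    linarith

/-- **Near-straightness from a CONDITIONAL curvature bound.**  Let `x` be `C²`, unit speed, `x′ 0 = e` (`‖e‖ = 1`), flat outside radius `R`
(`‖x σ‖ > R ⇒ x″ σ = 0`, `R ≥ 0`), and suppose that for every `T ≥ 0` near-straightness `‖x′ − e‖ ≤ θ₁` on `[0, T]` implies the curvature bound `‖x″‖ ≤ κ`
on `[0, T]`.  If `κ (2(R + ‖x 0‖) + 1) ≤ θ₀ < θ₁ ≤ ½` then `‖x′ τ − e‖ ≤ θ₀` for all `τ ≥ 0`. [folklore] -/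
theorem nearStraight_of_conditional_curvature {x : ℝ → EuclideanSpace ℝ (Fin 3)} (hx : ContDiff ℝ 2 x)
    {e : EuclideanSpace ℝ (Fin 3)} (he : ‖e‖ = 1) (h0 : deriv x 0 = e) {κ R θ₀ θ₁ : ℝ} (hκ : 0 ≤ κ) (hR : 0 ≤ R)
    (hθ₀ : κ * (2 * (R + ‖x 0‖) + 1) ≤ θ₀) (hθ : θ₀ < θ₁) (hθ₁ : θ₁ ≤ 1 / 2)
    (hcurv : ∀ T, 0 ≤ T → (∀ σ ∈ Icc 0 T, ‖deriv x σ - e‖ ≤ θ₁) → ∀ σ ∈ Icc 0 T, ‖iteratedDeriv 2 x σ‖ ≤ κ)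
    (hflat : ∀ σ, R < ‖x σ‖ → iteratedDeriv 2 x σ = 0) :
    ∀ τ, 0 ≤ τ → ‖deriv x τ - e‖ ≤ θ₀ := by
  have hθ₁0 : 0 ≤ θ₁ := by
    have : 0 ≤ κ * (2 * (R + ‖x 0‖) + 1) := by positivity
    linarith
  refine nearStraight_bootstrap (hx.of_le (by norm_num)) h0 hθ hθ₁0 fun T hT htilt σ hσ => ?_
  exact (tilt_le_of_curvature_of_exit hx he h0 hκ hR hθ₁ htilt (hcurv T hT htilt) hflat σ hσ).trans hθ₀

/-! ## §3 The backward half-line by time reversal -/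

/-- **Backward half-line.**  The same conclusion for `τ ≤ 0`, by applying `nearStraight_of_conditional_curvature` to the reversed curve
`σ ↦ x (−σ)` (unit speed, waist tangent `−e`, curvature `x″(−σ)`): a conditional curvature bound on the intervals `[−T, 0]`, flatness outside
radius `R`, and `κ(2(R + ‖x 0‖) + 1) ≤ θ₀ < θ₁ ≤ ½` give `‖x′ τ − e‖ ≤ θ₀` for all `τ ≤ 0`. [folklore] -/
theorem nearStraight_of_conditional_curvature_neg {x : ℝ → EuclideanSpace ℝ (Fin 3)} (hx : ContDiff ℝ 2 x)
    {e : EuclideanSpace ℝ (Fin 3)} (he : ‖e‖ = 1) (h0 : deriv x 0 = e) {κ R θ₀ θ₁ : ℝ} (hκ : 0 ≤ κ) (hR : 0 ≤ R)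
    (hθ₀ : κ * (2 * (R + ‖x 0‖) + 1) ≤ θ₀) (hθ : θ₀ < θ₁) (hθ₁ : θ₁ ≤ 1 / 2)
    (hcurv : ∀ T, 0 ≤ T → (∀ σ ∈ Icc (-T) 0, ‖deriv x σ - e‖ ≤ θ₁) → ∀ σ ∈ Icc (-T) 0, ‖iteratedDeriv 2 x σ‖ ≤ κ)
    (hflat : ∀ σ, R < ‖x σ‖ → iteratedDeriv 2 x σ = 0) :
    ∀ τ, τ ≤ 0 → ‖deriv x τ - e‖ ≤ θ₀ := by
  set y : ℝ → EuclideanSpace ℝ (Fin 3) := fun σ => x (-σ) with hy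
  have hyC : ContDiff ℝ 2 y := hx.comp contDiff_neg
  have hyd : ∀ σ, deriv y σ = -deriv x (-σ) := fun σ => by
    rw [hy]; exact deriv_comp_neg (f := x) (x := σ)
  have hy2 : ∀ σ, iteratedDeriv 2 y σ = iteratedDeriv 2 x (-σ) := fun σ => by
    rw [hy, iteratedDeriv_comp_neg 2 x σ]; norm_num
  have hne : ‖-e‖ = 1 := by rw [norm_neg, he]
  have hy0 : deriv y 0 = -e := by rw [hyd, neg_zero, h0]
  have hy00 : ‖y 0‖ = ‖x 0‖ := by simp [hy]
  have htilt_eq : ∀ σ, ‖deriv y σ - -e‖ = ‖deriv x (-σ) - e‖ := fun σ => by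
    rw [hyd, sub_neg_eq_add, ← neg_sub, norm_neg, sub_eq_neg_add]
  have key := nearStraight_of_conditional_curvature hyC hne hy0 hκ hR (by rw [hy00]; exact hθ₀) hθ hθ₁
    (fun T hT htilt σ hσ => by
      rw [hy2]
      refine hcurv T hT (fun ρ hρ => ?_) (-σ) ⟨by linarith [hσ.2], by linarith [hσ.1]⟩
      have h := htilt (-ρ) ⟨by linarith [hρ.2], by linarith [hρ.1]⟩
      rwa [htilt_eq, neg_neg] at h)
    (fun σ hσ => by rw [hy2]; exact hflat (-σ) (by simpa [hy] using hσ))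
  intro τ hτ
  have h := key (-τ) (by linarith)
  rwa [htilt_eq, neg_neg] at h

end Summit.NavierStokesRegularity.NavierStokesRegularity.Theorems.SkeletonJ1RFrame

end
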